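import Literature.Analysis.FluidPDE.TaoSpeedContinuation
import Literature.Analysis.FluidPDE.TaoAnnulusAssembly
import Literature.Analysis.FluidPDE.LerayLocalRegularH1
import HarnessLib

/-!
# Tao (2011/2013), Thm. 10.1 / Prop. 9.1 / Cor. 11.1 / Cor. 11.4: the two-leaf structure
# {nonlinear estimate `Y₆`, local `H¹` theory}

Bookkeeping file closing the decomposition of Tao 2011, Thm. 10.1 in the exterior form of
Remark 10.6 at unit viscosity (`tao2011_enstrophyLocalisation_exterior_unit`, `TaoUnitViscosity.lean`)
after the two files that landed last:

* `TaoAnnulusAssembly.lean` proves the §10 argument from the single static estimate for the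
  nonlinear term, `tao2011_enstrophyLocalisation_annulus_apriori_unit_of_nonlinearEstimate :
    tao2011_nonlinearEstimate → tao2011_enstrophyLocalisation_annulus_apriori_unit`;
* `TaoSpeedContinuation.lean` proves Prop. 9.1 for the vendored class from the a priori Thm. 10.1
  and Tao's almost regular local `H¹` theory (`TaoH1AlmostRegularWith`), in place of the printed
  Littlewood–Paley argument.

Combining them, the printed Thm. 10.1 (`ν = 1`), Prop. 9.1 (every `ν > 0`), Cor. 11.1 and the three
vendored forms of Cor. 11.4 follow from exactly **two** named facts of standard content:

1. `tao2011_nonlinearEstimate` (§10, the estimate (10.19)–(10.23) for `Y₆`: Whitney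
   decomposition, local Biot–Savart law, Sobolev/Poincaré on balls, parent-ball chaining), and
2. the local `H¹` theory with positive-time smoothing, in **either** of the two vendored forms:
   Tao's `tao2011_H1_local_almost_regular` (Thm. 5.4 (i)–(ii) + Prop. 5.6, `TaoH1AlmostRegular.lean`)
   or Leray's `leray_local_regular_H1` (Leray 1934, §§19–24; Ożański–Pooley 2018, Thm. 6.30 +
   Cor. 6.16, `LerayLocalRegularH1.lean`) — this file **proves** that Leray's package implies Tao's
   (`taoH1AlmostRegularWith_of_lerayLocalRegularH1With`: Leray's lifespan hypothesis
   `‖∇u₀‖⁴T ≤ cν³` is weaker than Tao's `‖u₀‖⁴_{H¹}T ≤ cν³`, and Leray's single classical solution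
   on `(0, T]` represents itself on every `[τ, T]`, the one-sided time derivatives within `[τ, T]`
   and within `(0, T]` agreeing there by joint smoothness).

Assemblies proved here (all one-liners on the tree's theorems):
`tao2011_enstrophyLocalisation_exterior_unit_of_nonlinearEstimate_of_almostRegular`,
`…_of_nonlinearEstimate_of_leray`, and the same two forms for `tao2011_boundedTotalSpeed`
(Prop. 9.1), `tao2011_boundedEnstrophy` (Cor. 11.1), `tao_unconditional_uniqueness` with its
velocity form and the duplicate vendoring (Cor. 11.4), and `tao2011_hasBoundedSobolevNormsOn`.

## Mathlib / tree search

`lean search 'of_nonlinearEstimate'`: `TaoAnnulusAssembly.lean` pairs `tao2011_nonlinearEstimate`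
with the Littlewood–Paley leaf `tao2011_duhamelNonlinearSpeed_unit`
(`tao_unconditional_uniqueness_of_nonlinear_duhamel_leaves`); no pairing with the local `H¹`
theory existed. `lean search 'TaoH1AlmostRegularWith|LerayLocalRegularH1With'`: no implication
between the two packages was recorded.

## References

* T. Tao, *Localisation and compactness properties of the Navier–Stokes global regularity
  problem*, Anal. PDE 6 (2013) 25–107 = arXiv:1108.1165 (`Tao2011`): Thm. 10.1 + Remark 10.6
  (arXiv Thm. 59, Rem. 64), Prop. 9.1 (Prop. 52), Thm. 5.4 + Prop. 5.6 (Thm. 31, Prop. 33),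
  Cor. 11.1 (Cor. 68), Cor. 11.4 + Remark 11.3 (Cor. 71).
* W. S. Ożański, B. C. Pooley, *Leray's fundamental work on the Navier–Stokes equations: a modern
  review*, LMS Lecture Notes 452, CUP 2018 (`OzanskiPooley2018`): Thm. 6.30, Cor. 6.16.
* J. Leray, Acta Math. 63 (1934) (`Leray1934`), Ch. III §§19–24.
-/

noncomputable section

open MeasureTheory Set Function Filter Topology
open scoped ENNReal NNReal ContDiff

namespace Literature.Analysis.FluidPDE

/-! ## Leray's local regular `H¹` package implies Tao's almost regular `H¹` package -/

/-- **Leray's local regular solutions are almost regular in Tao's sense** (same lifespan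
constant): given `LerayLocalRegularH1With c`, a divergence-free `u₀ ∈ H¹` with
`‖u₀‖⁴_{H¹}T ≤ cν³` has a fortiori `‖∇u₀‖⁴T ≤ cν³` (`eWeakGradL2Sq ≤ eH1NormSq`), so Leray's package
applies; its velocity `v` is Leray–Hopf from `u₀`, attains `u₀`, is `H¹`-continuous on `[0, T]`,
and with its pressure is a classical solution on `(0, T]` with all Sobolev norms of `v`, `∂ₜv`, `p`
bounded on every `[τ, T]`; restricted to `[τ, T]` (`IsClassicalNSSolutionOn.mono`; the one-sided
time derivative within `[τ, T]` equals that within `(0, T]` there,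
`IsSmoothSpaceTimeOn.timeDerivWithin_eq_of_subset`) it is the classical representative `(w, π)`
Tao's package asks for, with `v t = w t` everywhere. [cite: OzanskiPooley2018, Thm. 6.30 + Cor. 6.16; Tao2011, Thm. 5.4 (i)-(ii) and Prop. 5.6] -/
theorem taoH1AlmostRegularWith_of_lerayLocalRegularH1With {c : ℝ}
    (h : LerayLocalRegularH1With c) : TaoH1AlmostRegularWith c := by
  intro ν T hν hT u₀ hu₀ hdiv A hA hH1 hsmall
  have hgrad : eWeakGradL2Sq u₀ ≤ ENNReal.ofReal A :=
    le_trans (by rw [eH1NormSq_def]; exact le_add_self) hH1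
  obtain ⟨v, p, hLH, hv0, hreg, hcl, hbounds⟩ := h hν hT hu₀ hdiv hA hgrad hsmall
  refine ⟨v, hLH, hv0, hreg, fun τ hτ => ?_⟩
  obtain ⟨hHB, hHBt, -, hp⟩ := hbounds τ hτ.1 hτ.2.le
  have hsub : Icc τ T ⊆ Ioc 0 T := fun t ht => ⟨hτ.1.trans_le ht.1, ht.2⟩
  have hU : UniqueDiffOn ℝ (Icc τ T) := uniqueDiffOn_Icc hτ.2
  have hcl' : IsClassicalNSSolutionOn (Icc τ T) ν 0 v p := hcl.mono hsub hU
  have hderiv : ∀ t ∈ Icc τ T, timeDerivWithin (Icc τ T) v t = timeDerivWithin (Ioc 0 T) v t :=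
    fun t ht => funext fun x => hcl.smooth_velocity.timeDerivWithin_eq_of_subset hsub hU ht x
  exact ⟨v, p, hcl', hHB, hHBt.congr hderiv, hp, fun t _ => Filter.EventuallyEq.rfl⟩

/-- `leray_local_regular_H1 → tao2011_H1_local_almost_regular`. [cite: OzanskiPooley2018, Thm. 6.30 + Cor. 6.16] -/
theorem tao2011_H1_local_almost_regular_of_leray (h : leray_local_regular_H1) :
    tao2011_H1_local_almost_regular := by
  obtain ⟨c, hc, h⟩ := h
  exact ⟨c, hc, taoH1AlmostRegularWith_of_lerayLocalRegularH1With h⟩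

/-! ## The two-leaf assemblies -/

/-- **Thm. 10.1 (exterior form, `ν = 1`, as printed) from the nonlinear estimate `Y₆` and Tao's
almost regular local `H¹` theory.** [cite: Tao2011, Thm. 10.1 + Remark 10.6] -/
theorem tao2011_enstrophyLocalisation_exterior_unit_of_nonlinearEstimate_of_almostRegular
    (hY : tao2011_nonlinearEstimate) (hreg : tao2011_H1_local_almost_regular) :
    tao2011_enstrophyLocalisation_exterior_unit :=
  tao2011_enstrophyLocalisation_exterior_unit_of_almostRegular_of_annulus hreg
    (tao2011_enstrophyLocalisation_annulus_apriori_unit_of_nonlinearEstimate hY)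

/-- **Thm. 10.1 (exterior form, `ν = 1`, as printed) from the nonlinear estimate `Y₆` and Leray's
local regular `H¹` theory.** [cite: Tao2011, Thm. 10.1 + Remark 10.6] -/
theorem tao2011_enstrophyLocalisation_exterior_unit_of_nonlinearEstimate_of_leray
    (hY : tao2011_nonlinearEstimate) (hL : leray_local_regular_H1) :
    tao2011_enstrophyLocalisation_exterior_unit :=
  tao2011_enstrophyLocalisation_exterior_unit_of_nonlinearEstimate_of_almostRegular hY
    (tao2011_H1_local_almost_regular_of_leray hL)

/-- **Thm. 10.1 (exterior form, every `ν > 0`) from the two leaves.** [cite: Tao2011, Thm. 10.1 + Remark 10.6 + footnote 3] -/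
theorem tao2011_enstrophyLocalisation_exterior_of_nonlinearEstimate_of_almostRegular
    (hY : tao2011_nonlinearEstimate) (hreg : tao2011_H1_local_almost_regular) :
    tao2011_enstrophyLocalisation_exterior :=
  tao2011_enstrophyLocalisation_exterior_of_unit
    (tao2011_enstrophyLocalisation_exterior_unit_of_nonlinearEstimate_of_almostRegular hY hreg)

/-- **Prop. 9.1 (bounded total speed, every `ν > 0`) from the two leaves.** [cite: Tao2011, Prop. 9.1] -/
theorem tao2011_boundedTotalSpeed_of_nonlinearEstimate_of_almostRegular
    (hY : tao2011_nonlinearEstimate) (hreg : tao2011_H1_local_almost_regular) :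
    tao2011_boundedTotalSpeed :=
  tao2011_boundedTotalSpeed_of_almostRegular_of_annulus hreg
    (tao2011_enstrophyLocalisation_annulus_apriori_unit_of_nonlinearEstimate hY)

/-- **Prop. 9.1 from `Y₆` and Leray's local regular `H¹` theory.** [cite: Tao2011, Prop. 9.1] -/
theorem tao2011_boundedTotalSpeed_of_nonlinearEstimate_of_leray
    (hY : tao2011_nonlinearEstimate) (hL : leray_local_regular_H1) : tao2011_boundedTotalSpeed :=
  tao2011_boundedTotalSpeed_of_nonlinearEstimate_of_almostRegular hY
    (tao2011_H1_local_almost_regular_of_leray hL)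

/-- **Cor. 11.1 (bounded enstrophy, every `ν > 0`) from the two leaves.** [cite: Tao2011, Cor. 11.1] -/
theorem tao2011_boundedEnstrophy_of_nonlinearEstimate_of_almostRegular
    (hY : tao2011_nonlinearEstimate) (hreg : tao2011_H1_local_almost_regular) :
    tao2011_boundedEnstrophy :=
  tao2011_boundedEnstrophy_of_almostRegular_of_annulus hreg
    (tao2011_enstrophyLocalisation_annulus_apriori_unit_of_nonlinearEstimate hY)

/-- **Cor. 11.1 from `Y₆` and Leray's local regular `H¹` theory.** [cite: Tao2011, Cor. 11.1] -/
theorem tao2011_boundedEnstrophy_of_nonlinearEstimate_of_leray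
    (hY : tao2011_nonlinearEstimate) (hL : leray_local_regular_H1) : tao2011_boundedEnstrophy :=
  tao2011_boundedEnstrophy_of_nonlinearEstimate_of_almostRegular hY
    (tao2011_H1_local_almost_regular_of_leray hL)

/-- **Cor. 11.4 (as printed, velocity form, and the duplicate vendoring) from the two leaves.** [cite: Tao2011, Cor. 11.4 (Remark 11.3)] -/
theorem tao_unconditional_uniqueness_of_nonlinearEstimate_of_almostRegular
    (hY : tao2011_nonlinearEstimate) (hreg : tao2011_H1_local_almost_regular) :
    tao_unconditional_uniqueness ∧ tao_unconditional_uniqueness_velocity ∧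
      tao_finite_energy_velocity_uniqueness :=
  tao_unconditional_uniqueness_of_almostRegular_of_annulus hreg
    (tao2011_enstrophyLocalisation_annulus_apriori_unit_of_nonlinearEstimate hY)

/-- **Cor. 11.4 from `Y₆` and Leray's local regular `H¹` theory.** [cite: Tao2011, Cor. 11.4 (Remark 11.3)] -/
theorem tao_unconditional_uniqueness_of_nonlinearEstimate_of_leray
    (hY : tao2011_nonlinearEstimate) (hL : leray_local_regular_H1) :
    tao_unconditional_uniqueness ∧ tao_unconditional_uniqueness_velocity ∧
      tao_finite_energy_velocity_uniqueness :=
  tao_unconditional_uniqueness_of_nonlinearEstimate_of_almostRegular hY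
    (tao2011_H1_local_almost_regular_of_leray hL)

/-- **`tao2011_hasBoundedSobolevNormsOn` (Cor. 11.1 + Cor. 4.3 + Thm. 5.4 (iv)) from the two
leaves.** [cite: Tao2011, Cor. 11.1 + Cor. 4.3 + Thm. 5.4 (iv)] -/
theorem tao2011_hasBoundedSobolevNormsOn_of_nonlinearEstimate_of_almostRegular
    (hY : tao2011_nonlinearEstimate) (hreg : tao2011_H1_local_almost_regular) :
    tao2011_hasBoundedSobolevNormsOn :=
  tao2011_hasBoundedSobolevNormsOn_of_almostRegular_of_annulus hreg
    (tao2011_enstrophyLocalisation_annulus_apriori_unit_of_nonlinearEstimate hY)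

/-- **`tao2011_hasBoundedSobolevNormsOn` from `Y₆` and Leray's local regular `H¹` theory.** [cite: Tao2011, Cor. 11.1 + Cor. 4.3 + Thm. 5.4 (iv)] -/
theorem tao2011_hasBoundedSobolevNormsOn_of_nonlinearEstimate_of_leray
    (hY : tao2011_nonlinearEstimate) (hL : leray_local_regular_H1) :
    tao2011_hasBoundedSobolevNormsOn :=
  tao2011_hasBoundedSobolevNormsOn_of_nonlinearEstimate_of_almostRegular hY
    (tao2011_H1_local_almost_regular_of_leray hL)

end Literature.Analysis.FluidPDE

end
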